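import Literature.NumberTheory.Automorphic.UnitaryDepthZeroPieceStrataLabelTransportRamified   -- (this seat, A-file): label algebra under the frame ∕ under `U ∩ GL₃(𝒪_w)`, reduced frame identity, residual units, MASTER `ncard_fixedBy_label_eq_of_frame`
import HarnessLib

/-!
# «A1′ COUNT TRANSPORT», part 1 (B-file): the FIVE two-layer strata counts of ★ p847154 move from `Fix_t(G′_v ⧸ K′)` to the standard one-place model
# `Fix_{e t}(U(σ_w, Φ₃)(L_w) ⧸ U ∩ GL₃(𝒪_w))` along the frame `e g = A·g_w·A⁻¹` — bd∕0∕reg VERBATIM, the rank-1 class TWISTED by `c̄ = red(−det H′_w)` (tame-ramified non-split place)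

Topic `NumberTheory/Automorphic`; namespace `Literature.NumberTheory.Automorphic.UnitaryGroup`.  THEOREMS ONLY (no definition, no instance, no notation, no named fact, no `sorry`).
Hand F0P3a-p05 (g16), 2026-09-01.  Cell `pub/hodgecm-mathlib`, crux H413 = `stmt-HodgeConjecture-24833`; road «S3-ram» (LEAD F0P3a-plan (g12); owner∕table F0P3a-p06 (g15)); architect
A-p16 (g31) ROAD-P1ram v2, deal 23:15:56Z «(ii) A1′ COUNT TRANSPORT» (p05): v5's A′ assembly reads A1 (★ p847154) ∘ A1′ (this + the A-file) ∘ A2 (F0P3a-p01 (g16) (C5), lattice currency).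
PART 2 (cosets of `U(σ_w,Φ₃)` → fixed self-dual LATTICES with (a1)∕(a2)'s labels) follows once (C5)'s label tokens are posted.

THE MATHEMATICS ([Rogawski1990] §14.2 p. 233, §4.9 p. 54; [Kottwitz1986] §3).  With the frame of ★ p846897 (`e g = A·g_w·A⁻¹`, `g ∈ K′ ⟺ e g ∈ GL₃(𝒪_w)`) and the A-file's MASTER
transport (★ `ncard_fixedBy_sep_congr` with the membership conjunct added and removed), each stratum count of ★ p847154 equals the count of the corresponding stratum on the model side:
**`n_j(t) = n′_j(e t)`**, `j ∈ {bd, 0, reg, □, ¬□}`, the primed counts over `q′ ∈ Fix_{e t}(U ⧸ U ∩ GL₃(𝒪_w))` with `u := q′.out⁻¹ (e t) q′.out` and labels `rank(red u − 1) = 2` ∣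
`rank(red u − 1) = 0 ∧ rank N(u) = 0 ∕ 2` ∣ `rank(red u − 1) = 0 ∧ rank N(u) = 1 ∧ (¬)∃ z a, a ≠ 0 ∧ c̄·zᵀ(J₀N(u))z = a²` (`N(u) = red(ϖ⁻¹(u − 1))`, `J₀ = antidiag(1,1,1)` over
`𝓀_w`, `c̄ = red(−det H′_w)` — the FRAME TWIST of the A-file: `J̄ = c̄ • ᵗĀ J₀ Ā`).
HONEST LABEL: HC_CM is proved only modulo the 2 remaining named inputs (hLiu418 24832, h413 24833) until rung 0 closes; measure-free group bookkeeping, no books consequence.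

## References
* [Rogawski1990] J. D. Rogawski, *Automorphic Representations of Unitary Groups in Three Variables*, Ann. of Math. Stud. 123 (1990): §14.2 p. 233; §4.9 p. 54; §3.9 p. 32.
* [Kottwitz1986] R. E. Kottwitz, *Base change for unit elements of Hecke algebras*, Compositio Math. 60 (1986): §3 (fixed points on the building; congruence filtration).
* [PlatonovRapinchuk1994] V. Platonov, A. Rapinchuk, *Algebraic Groups and Number Theory* (1994): §3.3, §5.1.
-/

set_option autoImplicit false

noncomputable section

open MeasureTheory Measure Set Filter Topology NumberField IsDedekindDomain Matrix ValuativeRel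
open Literature.NumberTheory.Rogawski1990 Literature.NumberTheory.GaloisRepresentations Literature.NumberTheory.Automorphic.UnitaryGroup
open Literature.NumberTheory.Automorphic.IntegralReduction Literature.GroupTheory.SpecificGroups Literature.NumberTheory.Automorphic.UnitaryLatticeTree
open scoped Matrix MatrixGroups ValuativeRel

namespace Literature.NumberTheory.Automorphic.UnitaryGroup

/-! ## §3 The five strata counts of ★ p847154 transported to `U(σ_w, Φ₃)(L_w)` -/

section Transport

variable (L : Type) [Field L] [NumberField L] [IsCMField L] (H' : Matrix (Fin 3) (Fin 3) L) {v : HeightOneSpectrum (𝓞 ↥(maximalRealSubfield L))}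
  (w : PlacesOver L v) (hw : IsCMField.complexConj L • w.1 = w.1) (he : v.asIdeal.ramificationIdx' w.1.asIdeal ≠ 1)
  (hH'w : IsUnit (placeForm H' w.1)) (hH'i : hH'w.unit ∈ glInt 3 (w.1.adicCompletion L))
  (ϖ : (w.1.adicCompletion L)) (hϖ : Valued.v ϖ = WithZero.exp (-1 : ℤ))
  (A : GL (Fin 3) (w.1.adicCompletion L)) (hA : A ∈ glInt 3 (w.1.adicCompletion L))
  (hframe : (placeForm H' w.1) = (-(placeForm H' w.1).det) • formCongr (galAdicCompletionMap (L := L) (IsCMField.complexConj L) hw) A ((StdForm.antidiagonal 3).over (w.1.adicCompletion L)))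
  (e : ↥(UnitaryGroup.«local» L (IsCMField.complexConj L) 3 H' v) ≃ₜ* ↥(unitaryGroupOfForm (galAdicCompletionMap (L := L) (IsCMField.complexConj L) hw) (placeForm (Matrix.of fun i j : Fin 3 => if i.val + j.val + 1 = 3 then (1 : L) else 0) w.1)))
  (heA : ∀ g : ((cmDatum L 3 H').Local v), (((e g) : ↥(unitaryGroupOfForm (galAdicCompletionMap (L := L) (IsCMField.complexConj L) hw) (placeForm (Matrix.of fun i j : Fin 3 => if i.val + j.val + 1 = 3 then (1 : L) else 0) w.1))) : GL (Fin 3) (w.1.adicCompletion L)) =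
    A * ((localNonsplitEquiv (IsCMField.complexConj L) H' (IsCMField.complexConj_ne_one L) w hw g).val : GL (Fin 3) (w.1.adicCompletion L)) * A⁻¹)
  (hK : ∀ g : ((cmDatum L 3 H').Local v), g ∈ (cmLocalIntegralLevel L 3 H' v) ↔ (((e g) : ↥(unitaryGroupOfForm (galAdicCompletionMap (L := L) (IsCMField.complexConj L) hw) (placeForm (Matrix.of fun i j : Fin 3 => if i.val + j.val + 1 = 3 then (1 : L) else 0) w.1))) : GL (Fin 3) (w.1.adicCompletion L)) ∈ glInt 3 (w.1.adicCompletion L))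

include hw hϖ hA heA in
set_option maxHeartbeats 800000 in
-- budget only: statement-heavy CM-place tokens.
/-- **LABELS UNDER THE FRAME** (`x ∈ K′`, `e x = A x_w A⁻¹`): layer-1 rank equal; and on the interior (`rank(red x_w − 1) = 0`) the depth-1 residues are conjugate by the residual
unit `Ā = (red A, red A⁻¹)` with equal rank. [cite: Kottwitz1986, §3] [cite: Rogawski1990, §4.9 p. 54] -/
theorem labels_frame_of_mem {x : ((cmDatum L 3 H').Local v)} (hx : x ∈ (cmLocalIntegralLevel L 3 H' v)) :
    (redMat (((((e x) : ↥(unitaryGroupOfForm (galAdicCompletionMap (L := L) (IsCMField.complexConj L) hw) (placeForm (Matrix.of fun i j : Fin 3 => if i.val + j.val + 1 = 3 then (1 : L) else 0) w.1))) : GL (Fin 3) (w.1.adicCompletion L)) : Matrix (Fin 3) (Fin 3) (w.1.adicCompletion L))) - 1).rank = (redMat ((((x).val : GL (Fin 3) (UnitaryGroup.LocalRing L v)).val.map (Pi.evalRingHom (fun w' : PlacesOver L v => w'.1.adicCompletion L) w))) - 1).rank ∧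
    ((redMat ((((x).val : GL (Fin 3) (UnitaryGroup.LocalRing L v)).val.map (Pi.evalRingHom (fun w' : PlacesOver L v => w'.1.adicCompletion L) w))) - 1).rank = 0 →
      redMat (ϖ⁻¹ • (((((e x) : ↥(unitaryGroupOfForm (galAdicCompletionMap (L := L) (IsCMField.complexConj L) hw) (placeForm (Matrix.of fun i j : Fin 3 => if i.val + j.val + 1 = 3 then (1 : L) else 0) w.1))) : GL (Fin 3) (w.1.adicCompletion L)) : Matrix (Fin 3) (Fin 3) (w.1.adicCompletion L)) - 1)) = redMat (A : Matrix (Fin 3) (Fin 3) (w.1.adicCompletion L)) * redMat (ϖ⁻¹ • ((((x).val : GL (Fin 3) (UnitaryGroup.LocalRing L v)).val.map (Pi.evalRingHom (fun w' : PlacesOver L v => w'.1.adicCompletion L) w)) - 1)) * redMat (((A⁻¹ : GL (Fin 3) (w.1.adicCompletion L))) : Matrix (Fin 3) (Fin 3) (w.1.adicCompletion L)) ∧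
      (redMat (ϖ⁻¹ • (((((e x) : ↥(unitaryGroupOfForm (galAdicCompletionMap (L := L) (IsCMField.complexConj L) hw) (placeForm (Matrix.of fun i j : Fin 3 => if i.val + j.val + 1 = 3 then (1 : L) else 0) w.1))) : GL (Fin 3) (w.1.adicCompletion L)) : Matrix (Fin 3) (Fin 3) (w.1.adicCompletion L)) - 1))).rank = (redMat (ϖ⁻¹ • ((((x).val : GL (Fin 3) (UnitaryGroup.LocalRing L v)).val.map (Pi.evalRingHom (fun w' : PlacesOver L v => w'.1.adicCompletion L) w)) - 1))).rank) := by
  have hc1 : IsCMField.complexConj L ≠ 1 := IsCMField.complexConj_ne_one L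
  have hX : ((localNonsplitEquiv (IsCMField.complexConj L) H' hc1 w hw x).val : GL (Fin 3) (w.1.adicCompletion L)) ∈ glInt 3 (w.1.adicCompletion L) :=
    (mem_localIntegralLevel_iff_of_smul_eq (IsCMField.complexConj L) 3 H' hc1 w hw x).1 hx
  have hspell : (((x).val : GL (Fin 3) (UnitaryGroup.LocalRing L v)).val.map (Pi.evalRingHom (fun w' : PlacesOver L v => w'.1.adicCompletion L) w)) = (((localNonsplitEquiv (IsCMField.complexConj L) H' hc1 w hw x).val : GL (Fin 3) (w.1.adicCompletion L)) : Matrix (Fin 3) (Fin 3) (w.1.adicCompletion L)) :=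
    (coe_localNonsplitEquiv_apply L H' v w hw x).symm
  have hMe : ((((e x) : ↥(unitaryGroupOfForm (galAdicCompletionMap (L := L) (IsCMField.complexConj L) hw) (placeForm (Matrix.of fun i j : Fin 3 => if i.val + j.val + 1 = 3 then (1 : L) else 0) w.1))) : GL (Fin 3) (w.1.adicCompletion L)) : Matrix (Fin 3) (Fin 3) (w.1.adicCompletion L)) = (((A * ((localNonsplitEquiv (IsCMField.complexConj L) H' hc1 w hw x).val : GL (Fin 3) (w.1.adicCompletion L)) * A⁻¹ : GL (Fin 3) (w.1.adicCompletion L))) : Matrix (Fin 3) (Fin 3) (w.1.adicCompletion L)) :=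
    congrArg (fun g : GL (Fin 3) (w.1.adicCompletion L) => (g : Matrix (Fin 3) (Fin 3) (w.1.adicCompletion L))) (heA x)
  have hϖu : IsUniformizingElement ϖ := isUniformizingElement_of_v_eq hϖ
  refine ⟨by rw [hMe, hspell]; exact rank_redMat_frameConj_sub_one_eq hA hX, fun hr0 => ?_⟩
  have hr0' : (redMat ((((localNonsplitEquiv (IsCMField.complexConj L) H' hc1 w hw x).val : GL (Fin 3) (w.1.adicCompletion L)) : Matrix (Fin 3) (Fin 3) (w.1.adicCompletion L))) - 1).rank = 0 := by
    rw [← hspell]; exact hr0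
  refine ⟨?_, ?_⟩
  · rw [hMe, hspell]; exact redMat_inv_smul_frameConj_sub_one_eq hϖu hA hX hr0'
  · rw [hMe, hspell]; exact rank_redMat_inv_smul_frameConj_sub_one_eq hϖu hA hX hr0'

include hw he hϖ in
set_option maxHeartbeats 800000 in
-- budget only: statement-heavy CM-place tokens.
/-- **LABELS UNDER `U ∩ GL₃(𝒪_w)`-CONJUGATION** (`k′, u ∈ U ∩ GL₃(𝒪_w)`): layer-1 rank invariant; on the interior the depth-1 residues are conjugate by a residual unit `ḡ ∈ O(J₀)(𝓀_w)`
(`N(k′⁻¹uk′) = ḡ⁻¹N(u)ḡ`, `ḡ = red k′`) with equal rank — so the twisted class `∃ z a, a ≠ 0 ∧ c·zᵀ(J₀N)z = a²` is invariant (★ `dotProduct_mulVec_conj_of_mem`).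
[cite: Kottwitz1986, §3] [cite: Rogawski1990, §3.9 p. 32] -/
theorem labels_conj_of_mem_glInt {k' u : ↥(unitaryGroupOfForm (galAdicCompletionMap (L := L) (IsCMField.complexConj L) hw) (placeForm (Matrix.of fun i j : Fin 3 => if i.val + j.val + 1 = 3 then (1 : L) else 0) w.1))} (hk' : ((k' : ↥(unitaryGroupOfForm (galAdicCompletionMap (L := L) (IsCMField.complexConj L) hw) (placeForm (Matrix.of fun i j : Fin 3 => if i.val + j.val + 1 = 3 then (1 : L) else 0) w.1))) : GL (Fin 3) (w.1.adicCompletion L)) ∈ glInt 3 (w.1.adicCompletion L)) (hu : ((u : ↥(unitaryGroupOfForm (galAdicCompletionMap (L := L) (IsCMField.complexConj L) hw) (placeForm (Matrix.of fun i j : Fin 3 => if i.val + j.val + 1 = 3 then (1 : L) else 0) w.1))) : GL (Fin 3) (w.1.adicCompletion L)) ∈ glInt 3 (w.1.adicCompletion L)) :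
    ((redMat (((((k'⁻¹ * u * k') : ↥(unitaryGroupOfForm (galAdicCompletionMap (L := L) (IsCMField.complexConj L) hw) (placeForm (Matrix.of fun i j : Fin 3 => if i.val + j.val + 1 = 3 then (1 : L) else 0) w.1))) : GL (Fin 3) (w.1.adicCompletion L)) : Matrix (Fin 3) (Fin 3) (w.1.adicCompletion L))) - 1).rank = 2 ↔ (redMat ((((u : ↥(unitaryGroupOfForm (galAdicCompletionMap (L := L) (IsCMField.complexConj L) hw) (placeForm (Matrix.of fun i j : Fin 3 => if i.val + j.val + 1 = 3 then (1 : L) else 0) w.1))) : GL (Fin 3) (w.1.adicCompletion L)) : Matrix (Fin 3) (Fin 3) (w.1.adicCompletion L))) - 1).rank = 2) ∧ ((redMat (((((k'⁻¹ * u * k') : ↥(unitaryGroupOfForm (galAdicCompletionMap (L := L) (IsCMField.complexConj L) hw) (placeForm (Matrix.of fun i j : Fin 3 => if i.val + j.val + 1 = 3 then (1 : L) else 0) w.1))) : GL (Fin 3) (w.1.adicCompletion L)) : Matrix (Fin 3) (Fin 3) (w.1.adicCompletion L))) - 1).rank = 0 ↔ (redMat ((((u : ↥(unitaryGroupOfForm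 (galAdicCompletionMap (L := L) (IsCMField.complexConj L) hw) (placeForm (Matrix.of fun i j : Fin 3 => if i.val + j.val + 1 = 3 then (1 : L) else 0) w.1))) : GL (Fin 3) (w.1.adicCompletion L)) : Matrix (Fin 3) (Fin 3) (w.1.adicCompletion L))) - 1).rank = 0) ∧
    ((redMat ((((u : ↥(unitaryGroupOfForm (galAdicCompletionMap (L := L) (IsCMField.complexConj L) hw) (placeForm (Matrix.of fun i j : Fin 3 => if i.val + j.val + 1 = 3 then (1 : L) else 0) w.1))) : GL (Fin 3) (w.1.adicCompletion L)) : Matrix (Fin 3) (Fin 3) (w.1.adicCompletion L))) - 1).rank = 0 →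
      (redMat (ϖ⁻¹ • (((((k'⁻¹ * u * k') : ↥(unitaryGroupOfForm (galAdicCompletionMap (L := L) (IsCMField.complexConj L) hw) (placeForm (Matrix.of fun i j : Fin 3 => if i.val + j.val + 1 = 3 then (1 : L) else 0) w.1))) : GL (Fin 3) (w.1.adicCompletion L)) : Matrix (Fin 3) (Fin 3) (w.1.adicCompletion L)) - 1))).rank = (redMat (ϖ⁻¹ • ((((u : ↥(unitaryGroupOfForm (galAdicCompletionMap (L := L) (IsCMField.complexConj L) hw) (placeForm (Matrix.of fun i j : Fin 3 => if i.val + j.val + 1 = 3 then (1 : L) else 0) w.1))) : GL (Fin 3) (w.1.adicCompletion L)) : Matrix (Fin 3) (Fin 3) (w.1.adicCompletion L)) - 1))).rank ∧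
      ∀ c : 𝓀[(w.1.adicCompletion L)], ((∃ (z : Fin 3 → 𝓀[(w.1.adicCompletion L)]) (a : 𝓀[(w.1.adicCompletion L)]), a ≠ 0 ∧ c * (z ⬝ᵥ ((((StdForm.antidiagonal 3).over 𝓀[(w.1.adicCompletion L)]) * redMat (ϖ⁻¹ • (((((k'⁻¹ * u * k') : ↥(unitaryGroupOfForm (galAdicCompletionMap (L := L) (IsCMField.complexConj L) hw) (placeForm (Matrix.of fun i j : Fin 3 => if i.val + j.val + 1 = 3 then (1 : L) else 0) w.1))) : GL (Fin 3) (w.1.adicCompletion L)) : Matrix (Fin 3) (Fin 3) (w.1.adicCompletion L)) - 1))) *ᵥ z)) = a ^ 2) ↔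
        ∃ (z : Fin 3 → 𝓀[(w.1.adicCompletion L)]) (a : 𝓀[(w.1.adicCompletion L)]), a ≠ 0 ∧ c * (z ⬝ᵥ ((((StdForm.antidiagonal 3).over 𝓀[(w.1.adicCompletion L)]) * redMat (ϖ⁻¹ • ((((u : ↥(unitaryGroupOfForm (galAdicCompletionMap (L := L) (IsCMField.complexConj L) hw) (placeForm (Matrix.of fun i j : Fin 3 => if i.val + j.val + 1 = 3 then (1 : L) else 0) w.1))) : GL (Fin 3) (w.1.adicCompletion L)) : Matrix (Fin 3) (Fin 3) (w.1.adicCompletion L)) - 1))) *ᵥ z)) = a ^ 2)) := by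
  have hϖu : IsUniformizingElement ϖ := isUniformizingElement_of_v_eq hϖ
  refine ⟨rank_redMat_coe_conj_sub_one_eq_iff (unitaryGroupOfForm (galAdicCompletionMap (L := L) (IsCMField.complexConj L) hw) (placeForm (Matrix.of fun i j : Fin 3 => if i.val + j.val + 1 = 3 then (1 : L) else 0) w.1)) hk' hu 2, rank_redMat_coe_conj_sub_one_eq_iff (unitaryGroupOfForm (galAdicCompletionMap (L := L) (IsCMField.complexConj L) hw) (placeForm (Matrix.of fun i j : Fin 3 => if i.val + j.val + 1 = 3 then (1 : L) else 0) w.1)) hk' hu 0, fun hr0 => ?_⟩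
  -- `k′⁻¹ u k′ = B u B⁻¹` with `B := (k′)⁻¹ ∈ GL₃(𝒪_w)`
  have hcoe : (((k'⁻¹ * u * k' : ↥(unitaryGroupOfForm (galAdicCompletionMap (L := L) (IsCMField.complexConj L) hw) (placeForm (Matrix.of fun i j : Fin 3 => if i.val + j.val + 1 = 3 then (1 : L) else 0) w.1)))) : GL (Fin 3) (w.1.adicCompletion L)) =
      ((k' : ↥(unitaryGroupOfForm (galAdicCompletionMap (L := L) (IsCMField.complexConj L) hw) (placeForm (Matrix.of fun i j : Fin 3 => if i.val + j.val + 1 = 3 then (1 : L) else 0) w.1))) : GL (Fin 3) (w.1.adicCompletion L))⁻¹ * ((u : ↥(unitaryGroupOfForm (galAdicCompletionMap (L := L) (IsCMField.complexConj L) hw) (placeForm (Matrix.of fun i j : Fin 3 => if i.val + j.val + 1 = 3 then (1 : L) else 0) w.1))) : GL (Fin 3) (w.1.adicCompletion L)) * (((k' : ↥(unitaryGroupOfForm (galAdicCompletionMap (L := L) (IsCMField.complexConj L) hw) (placeForm (Matrix.of fun i j : Fin 3 => if i.val + j.val + 1 = 3 then (1 : L) else 0) w.1))) : GL (Fin 3)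 (w.1.adicCompletion L))⁻¹)⁻¹ := by
    rw [inv_inv, Subgroup.coe_mul, Subgroup.coe_mul, Subgroup.coe_inv]
  have hN : redMat (ϖ⁻¹ • (((((k'⁻¹ * u * k') : ↥(unitaryGroupOfForm (galAdicCompletionMap (L := L) (IsCMField.complexConj L) hw) (placeForm (Matrix.of fun i j : Fin 3 => if i.val + j.val + 1 = 3 then (1 : L) else 0) w.1))) : GL (Fin 3) (w.1.adicCompletion L)) : Matrix (Fin 3) (Fin 3) (w.1.adicCompletion L)) - 1)) =
      redMat (((((k' : ↥(unitaryGroupOfForm (galAdicCompletionMap (L := L) (IsCMField.complexConj L) hw) (placeForm (Matrix.of fun i j : Fin 3 => if i.val + j.val + 1 = 3 then (1 : L) else 0) w.1))) : GL (Fin 3) (w.1.adicCompletion L))⁻¹ : GL (Fin 3) (w.1.adicCompletion L))) : Matrix (Fin 3) (Fin 3) (w.1.adicCompletion L)) * redMat (ϖ⁻¹ • ((((u : ↥(unitaryGroupOfForm (galAdicCompletionMap (L := L) (IsCMField.complexConj L) hw) (placeForm (Matrix.of fun i j : Fin 3 => if i.val + j.val + 1 = 3 then (1 : L) else 0) w.1)))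 : GL (Fin 3) (w.1.adicCompletion L)) : Matrix (Fin 3) (Fin 3) (w.1.adicCompletion L)) - 1)) * redMat (((k' : ↥(unitaryGroupOfForm (galAdicCompletionMap (L := L) (IsCMField.complexConj L) hw) (placeForm (Matrix.of fun i j : Fin 3 => if i.val + j.val + 1 = 3 then (1 : L) else 0) w.1))) : GL (Fin 3) (w.1.adicCompletion L)) : Matrix (Fin 3) (Fin 3) (w.1.adicCompletion L)) := by
    have h := redMat_inv_smul_frameConj_sub_one_eq hϖu (inv_mem hk') hu hr0
    rw [inv_inv] at h
    rw [hcoe]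
    exact h
  obtain ⟨g, hg, hgc, hgi⟩ := exists_residual_orthogonal_of_mem_glInt L w hw he hk'
  have hN' : redMat (ϖ⁻¹ • (((((k'⁻¹ * u * k') : ↥(unitaryGroupOfForm (galAdicCompletionMap (L := L) (IsCMField.complexConj L) hw) (placeForm (Matrix.of fun i j : Fin 3 => if i.val + j.val + 1 = 3 then (1 : L) else 0) w.1))) : GL (Fin 3) (w.1.adicCompletion L)) : Matrix (Fin 3) (Fin 3) (w.1.adicCompletion L)) - 1)) = ((g⁻¹ : GL (Fin 3) 𝓀[(w.1.adicCompletion L)]) : Matrix (Fin 3) (Fin 3) 𝓀[(w.1.adicCompletion L)]) * redMat (ϖ⁻¹ • ((((u : ↥(unitaryGroupOfForm (galAdicCompletionMap (L := L) (IsCMField.complexConj L) hw) (placeForm (Matrix.of fun i j : Fin 3 => if i.val + j.val + 1 = 3 then (1 : L) else 0) w.1))) : GL (Fin 3) (w.1.adicCompletion L)) : Matrix (Fin 3) (Fin 3) (w.1.adicCompletion L)) - 1)) * (g : Matrix (Fin 3) (Fin 3) 𝓀[(w.1.adicCompletion L)]) := by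
    rw [hN, hgc, hgi]
  refine ⟨?_, fun c => ?_⟩
  · rw [hN']
    have h1 : (g : Matrix (Fin 3) (Fin 3) 𝓀[(w.1.adicCompletion L)]) * ((g⁻¹ : GL (Fin 3) 𝓀[(w.1.adicCompletion L)]) : Matrix (Fin 3) (Fin 3) 𝓀[(w.1.adicCompletion L)]) = 1 := by
      rw [← Units.val_mul, mul_inv_cancel, Units.val_one]
    have h2 : ((g⁻¹ : GL (Fin 3) 𝓀[(w.1.adicCompletion L)]) : Matrix (Fin 3) (Fin 3) 𝓀[(w.1.adicCompletion L)]) * (g : Matrix (Fin 3) (Fin 3) 𝓀[(w.1.adicCompletion L)]) = 1 := by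
      rw [← Units.val_mul, inv_mul_cancel, Units.val_one]
    rw [Matrix.rank_mul_eq_left_of_isUnit_det _ _ (Matrix.isUnit_det_of_right_inverse h1),
      Matrix.rank_mul_eq_right_of_isUnit_det _ _ (Matrix.isUnit_det_of_right_inverse h2)]
  · rw [hN']
    exact exists_sq_value_conj_iff_of_mem hg c _

include hw he hϖ hA heA hK in
set_option maxHeartbeats 1600000 in
-- budget only: statement-heavy CM-place tokens (two coset currencies).
/-- **A1′ (bd)**: `n_bd(t) = n′_bd(e t)` — the boundary stratum `rank(red x_w − 1) = 2` transported along the frame. [cite: Rogawski1990, §14.2 p. 233; §4.9 p. 54] [cite: Kottwitz1986, §3] -/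
theorem ncard_fixedBy_bd_eq_of_frame (t : ((cmDatum L 3 H').Local v)) :
    {q : (((cmDatum L 3 H').Local v) ⧸ cmLocalIntegralLevel L 3 H' v) | q ∈ MulAction.fixedBy (((cmDatum L 3 H').Local v) ⧸ cmLocalIntegralLevel L 3 H' v) t ∧ (redMat (((((q.out⁻¹ * t * q.out)).val : GL (Fin 3) (UnitaryGroup.LocalRing L v)).val.map (Pi.evalRingHom (fun w' : PlacesOver L v => w'.1.adicCompletion L) w))) - 1).rank = 2}.ncard =
      {q : (↥(unitaryGroupOfForm (galAdicCompletionMap (L := L) (IsCMField.complexConj L) hw) (placeForm (Matrix.of fun i j : Fin 3 => if i.val + j.val + 1 = 3 then (1 : L) else 0) w.1)) ⧸ ((glInt 3 (w.1.adicCompletion L)).subgroupOf (unitaryGroupOfForm (galAdicCompletionMap (L := L) (IsCMField.complexConj L) hw) (placeForm (Matrix.of fun i j : Fin 3 => if i.val + j.val + 1 = 3 then (1 : L) else 0) w.1)))) | q ∈ MulAction.fixedBy (↥(unitaryGroupOfForm (galAdicCompletionMap (L := L) (IsCMField.complexConj L) hw) (placeForm (Matrix.of fun i j : Fin 3 =>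 if i.val + j.val + 1 = 3 then (1 : L) else 0) w.1)) ⧸ ((glInt 3 (w.1.adicCompletion L)).subgroupOf (unitaryGroupOfForm (galAdicCompletionMap (L := L) (IsCMField.complexConj L) hw) (placeForm (Matrix.of fun i j : Fin 3 => if i.val + j.val + 1 = 3 then (1 : L) else 0) w.1)))) (e t) ∧ (redMat (((((q.out⁻¹ * e t * q.out) : ↥(unitaryGroupOfForm (galAdicCompletionMap (L := L) (IsCMField.complexConj L) hw) (placeForm (Matrix.of fun i j : Fin 3 => if i.val + j.val + 1 = 3 then (1 : L) else 0) w.1))) : GL (Fin 3) (w.1.adicCompletion L)) : Matrix (Fin 3) (Fin 3) (w.1.adicCompletion L))) - 1).rank = 2}.ncard :=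
  ncard_fixedBy_label_eq_of_frame L H' w hw e hK t (fun x => (redMat ((((x).val : GL (Fin 3) (UnitaryGroup.LocalRing L v)).val.map (Pi.evalRingHom (fun w' : PlacesOver L v => w'.1.adicCompletion L) w))) - 1).rank = 2) (fun u => (redMat ((((u : ↥(unitaryGroupOfForm (galAdicCompletionMap (L := L) (IsCMField.complexConj L) hw) (placeForm (Matrix.of fun i j : Fin 3 => if i.val + j.val + 1 = 3 then (1 : L) else 0) w.1))) : GL (Fin 3) (w.1.adicCompletion L)) : Matrix (Fin 3) (Fin 3) (w.1.adicCompletion L))) - 1).rank = 2)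
    (fun x hx => by rw [(labels_frame_of_mem L H' w hw ϖ hϖ A hA e heA hx).1])
    (fun k' hk' u hu => (labels_conj_of_mem_glInt L w hw he ϖ hϖ hk' hu).1)

include hw he hϖ hA heA hK in
set_option maxHeartbeats 1600000 in
-- budget only: statement-heavy CM-place tokens (two coset currencies).
/-- **A1′ (0)**: `n_0(t) = n′_0(e t)` — the interior stratum `rank(red x_w − 1) = 0 ∧ rank N(x) = 0`. [cite: Rogawski1990, §14.2 p. 233; §4.9 p. 54] [cite: Kottwitz1986, §3] -/
theorem ncard_fixedBy_interior_zero_eq_of_frame (t : ((cmDatum L 3 H').Local v)) :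
    {q : (((cmDatum L 3 H').Local v) ⧸ cmLocalIntegralLevel L 3 H' v) | q ∈ MulAction.fixedBy (((cmDatum L 3 H').Local v) ⧸ cmLocalIntegralLevel L 3 H' v) t ∧ ((redMat (((((q.out⁻¹ * t * q.out)).val : GL (Fin 3) (UnitaryGroup.LocalRing L v)).val.map (Pi.evalRingHom (fun w' : PlacesOver L v => w'.1.adicCompletion L) w))) - 1).rank = 0 ∧ (redMat (ϖ⁻¹ • (((((q.out⁻¹ * t * q.out)).val : GL (Fin 3) (UnitaryGroup.LocalRing L v)).val.map (Pi.evalRingHom (fun w' : PlacesOver L v => w'.1.adicCompletion L) w)) - 1))).rank = 0)}.ncard =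
      {q : (↥(unitaryGroupOfForm (galAdicCompletionMap (L := L) (IsCMField.complexConj L) hw) (placeForm (Matrix.of fun i j : Fin 3 => if i.val + j.val + 1 = 3 then (1 : L) else 0) w.1)) ⧸ ((glInt 3 (w.1.adicCompletion L)).subgroupOf (unitaryGroupOfForm (galAdicCompletionMap (L := L) (IsCMField.complexConj L) hw) (placeForm (Matrix.of fun i j : Fin 3 => if i.val + j.val + 1 = 3 then (1 : L) else 0) w.1)))) | q ∈ MulAction.fixedBy (↥(unitaryGroupOfForm (galAdicCompletionMap (L := L) (IsCMField.complexConj L) hw) (placeForm (Matrix.of fun i j : Fin 3 => if i.val + j.val + 1 = 3 then (1 : L) else 0) w.1)) ⧸ ((glInt 3 (w.1.adicCompletion L)).subgroupOf (unitaryGroupOfForm (galAdicCompletionMap (L := L) (IsCMField.complexConj L) hw) (placeForm (Matrix.of fun i j : Fin 3 => if i.val + j.val + 1 = 3 then (1 : L) else 0) w.1)))) (e t) ∧ ((redMat (((((q.out⁻¹ * e t * q.out) : ↥(unitaryGroupOfForm (galAdicCompletionMap (L := L) (IsCMField.complexConj L) hw) (placeForm (Matrix.of fun i j : Fin 3 =>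 if i.val + j.val + 1 = 3 then (1 : L) else 0) w.1))) : GL (Fin 3) (w.1.adicCompletion L)) : Matrix (Fin 3) (Fin 3) (w.1.adicCompletion L))) - 1).rank = 0 ∧ (redMat (ϖ⁻¹ • (((((q.out⁻¹ * e t * q.out) : ↥(unitaryGroupOfForm (galAdicCompletionMap (L := L) (IsCMField.complexConj L) hw) (placeForm (Matrix.of fun i j : Fin 3 => if i.val + j.val + 1 = 3 then (1 : L) else 0) w.1))) : GL (Fin 3) (w.1.adicCompletion L)) : Matrix (Fin 3) (Fin 3) (w.1.adicCompletion L)) - 1))).rank = 0)}.ncard :=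
  ncard_fixedBy_label_eq_of_frame L H' w hw e hK t (fun x => (redMat ((((x).val : GL (Fin 3) (UnitaryGroup.LocalRing L v)).val.map (Pi.evalRingHom (fun w' : PlacesOver L v => w'.1.adicCompletion L) w))) - 1).rank = 0 ∧ (redMat (ϖ⁻¹ • ((((x).val : GL (Fin 3) (UnitaryGroup.LocalRing L v)).val.map (Pi.evalRingHom (fun w' : PlacesOver L v => w'.1.adicCompletion L) w)) - 1))).rank = 0) (fun u => (redMat ((((u : ↥(unitaryGroupOfForm (galAdicCompletionMap (L := L) (IsCMField.complexConj L) hw) (placeForm (Matrix.of fun i j : Fin 3 => if i.val + j.val + 1 = 3 then (1 : L) else 0) w.1))) : GL (Fin 3) (w.1.adicCompletion L)) : Matrix (Fin 3) (Fin 3) (w.1.adicCompletion L))) - 1).rank = 0 ∧ (redMat (ϖ⁻¹ • ((((u : ↥(unitaryGroupOfForm (galAdicCompletionMap (L := L) (IsCMField.complexConj L) hw) (placeForm (Matrix.of fun i j : Fin 3 => if i.val + j.val + 1 = 3 then (1 : L) else 0) w.1))) : GL (Fin 3) (w.1.adicCompletion L)) : Matrix (Fin 3) (Fin 3) (w.1.adicCompletion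 L)) - 1))).rank = 0)
    (fun x hx => by
      obtain ⟨h1, h2⟩ := labels_frame_of_mem L H' w hw ϖ hϖ A hA e heA hx
      constructor
      · rintro ⟨hr0, hr⟩; exact ⟨by rw [h1]; exact hr0, by rw [(h2 hr0).2]; exact hr⟩
      · rintro ⟨hr0, hr⟩
        have hr0' : (redMat ((((x).val : GL (Fin 3) (UnitaryGroup.LocalRing L v)).val.map (Pi.evalRingHom (fun w' : PlacesOver L v => w'.1.adicCompletion L) w))) - 1).rank = 0 := by rw [← h1]; exact hr0
        exact ⟨hr0', by rw [← (h2 hr0').2]; exact hr⟩)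
    (fun k' hk' u hu => by
      obtain ⟨-, h0, h⟩ := labels_conj_of_mem_glInt L w hw he ϖ hϖ hk' hu
      constructor
      · rintro ⟨hr0, hr⟩
        have hr0' := h0.1 hr0
        exact ⟨hr0', by rw [← (h hr0').1]; exact hr⟩
      · rintro ⟨hr0, hr⟩; exact ⟨h0.2 hr0, by rw [(h hr0).1]; exact hr⟩)

include hw he hϖ hA heA hK in
set_option maxHeartbeats 1600000 in
-- budget only: statement-heavy CM-place tokens (two coset currencies).
/-- **A1′ (reg)**: `n_reg(t) = n′_reg(e t)` — the interior stratum `rank(red x_w − 1) = 0 ∧ rank N(x) = 2`. [cite: Rogawski1990, §14.2 p. 233; §4.9 p. 54] [cite: Kottwitz1986, §3] -/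
theorem ncard_fixedBy_interior_reg_eq_of_frame (t : ((cmDatum L 3 H').Local v)) :
    {q : (((cmDatum L 3 H').Local v) ⧸ cmLocalIntegralLevel L 3 H' v) | q ∈ MulAction.fixedBy (((cmDatum L 3 H').Local v) ⧸ cmLocalIntegralLevel L 3 H' v) t ∧ ((redMat (((((q.out⁻¹ * t * q.out)).val : GL (Fin 3) (UnitaryGroup.LocalRing L v)).val.map (Pi.evalRingHom (fun w' : PlacesOver L v => w'.1.adicCompletion L) w))) - 1).rank = 0 ∧ (redMat (ϖ⁻¹ • (((((q.out⁻¹ * t * q.out)).val : GL (Fin 3) (UnitaryGroup.LocalRing L v)).val.map (Pi.evalRingHom (fun w' : PlacesOver L v => w'.1.adicCompletion L) w)) - 1))).rank = 2)}.ncard =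
      {q : (↥(unitaryGroupOfForm (galAdicCompletionMap (L := L) (IsCMField.complexConj L) hw) (placeForm (Matrix.of fun i j : Fin 3 => if i.val + j.val + 1 = 3 then (1 : L) else 0) w.1)) ⧸ ((glInt 3 (w.1.adicCompletion L)).subgroupOf (unitaryGroupOfForm (galAdicCompletionMap (L := L) (IsCMField.complexConj L) hw) (placeForm (Matrix.of fun i j : Fin 3 => if i.val + j.val + 1 = 3 then (1 : L) else 0) w.1)))) | q ∈ MulAction.fixedBy (↥(unitaryGroupOfForm (galAdicCompletionMap (L := L) (IsCMField.complexConj L) hw) (placeForm (Matrix.of fun i j : Fin 3 => if i.val + j.val + 1 = 3 then (1 : L) else 0) w.1)) ⧸ ((glInt 3 (w.1.adicCompletion L)).subgroupOf (unitaryGroupOfForm (galAdicCompletionMap (L := L) (IsCMField.complexConj L) hw) (placeForm (Matrix.of fun i j : Fin 3 => if i.val + j.val + 1 = 3 then (1 : L) else 0) w.1)))) (e t) ∧ ((redMat (((((q.out⁻¹ * e t * q.out) : ↥(unitaryGroupOfForm (galAdicCompletionMap (L := L) (IsCMField.complexConj L) hw) (placeForm (Matrix.of fun i j : Fin 3 =>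 if i.val + j.val + 1 = 3 then (1 : L) else 0) w.1))) : GL (Fin 3) (w.1.adicCompletion L)) : Matrix (Fin 3) (Fin 3) (w.1.adicCompletion L))) - 1).rank = 0 ∧ (redMat (ϖ⁻¹ • (((((q.out⁻¹ * e t * q.out) : ↥(unitaryGroupOfForm (galAdicCompletionMap (L := L) (IsCMField.complexConj L) hw) (placeForm (Matrix.of fun i j : Fin 3 => if i.val + j.val + 1 = 3 then (1 : L) else 0) w.1))) : GL (Fin 3) (w.1.adicCompletion L)) : Matrix (Fin 3) (Fin 3) (w.1.adicCompletion L)) - 1))).rank = 2)}.ncard :=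
  ncard_fixedBy_label_eq_of_frame L H' w hw e hK t (fun x => (redMat ((((x).val : GL (Fin 3) (UnitaryGroup.LocalRing L v)).val.map (Pi.evalRingHom (fun w' : PlacesOver L v => w'.1.adicCompletion L) w))) - 1).rank = 0 ∧ (redMat (ϖ⁻¹ • ((((x).val : GL (Fin 3) (UnitaryGroup.LocalRing L v)).val.map (Pi.evalRingHom (fun w' : PlacesOver L v => w'.1.adicCompletion L) w)) - 1))).rank = 2) (fun u => (redMat ((((u : ↥(unitaryGroupOfForm (galAdicCompletionMap (L := L) (IsCMField.complexConj L) hw) (placeForm (Matrix.of fun i j : Fin 3 => if i.val + j.val + 1 = 3 then (1 : L) else 0) w.1))) : GL (Fin 3) (w.1.adicCompletion L)) : Matrix (Fin 3) (Fin 3) (w.1.adicCompletion L))) - 1).rank = 0 ∧ (redMat (ϖ⁻¹ • ((((u : ↥(unitaryGroupOfForm (galAdicCompletionMap (L := L) (IsCMField.complexConj L) hw) (placeForm (Matrix.of fun i j : Fin 3 => if i.val + j.val + 1 = 3 then (1 : L) else 0) w.1))) : GL (Fin 3) (w.1.adicCompletion L)) : Matrix (Fin 3) (Fin 3) (w.1.adicCompletion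 L)) - 1))).rank = 2)
    (fun x hx => by
      obtain ⟨h1, h2⟩ := labels_frame_of_mem L H' w hw ϖ hϖ A hA e heA hx
      constructor
      · rintro ⟨hr0, hr⟩; exact ⟨by rw [h1]; exact hr0, by rw [(h2 hr0).2]; exact hr⟩
      · rintro ⟨hr0, hr⟩
        have hr0' : (redMat ((((x).val : GL (Fin 3) (UnitaryGroup.LocalRing L v)).val.map (Pi.evalRingHom (fun w' : PlacesOver L v => w'.1.adicCompletion L) w))) - 1).rank = 0 := by rw [← h1]; exact hr0
        exact ⟨hr0', by rw [← (h2 hr0').2]; exact hr⟩)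
    (fun k' hk' u hu => by
      obtain ⟨-, h0, h⟩ := labels_conj_of_mem_glInt L w hw he ϖ hϖ hk' hu
      constructor
      · rintro ⟨hr0, hr⟩
        have hr0' := h0.1 hr0
        exact ⟨hr0', by rw [← (h hr0').1]; exact hr⟩
      · rintro ⟨hr0, hr⟩; exact ⟨h0.2 hr0, by rw [(h hr0).1]; exact hr⟩)

include hw he hH'w hH'i hϖ hA hframe heA hK in
set_option maxHeartbeats 1600000 in
-- budget only: statement-heavy CM-place tokens (two coset currencies).
/-- **A1′ (□)**: `n_□(t) = n′_□(e t)` — the interior rank-1 stratum of class □; on the model side the class reads with the FRAME TWIST `c̄ = red(−det H′_w)`: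
`∃ z a, a ≠ 0 ∧ c̄·zᵀ(J₀N(u))z = a²`. [cite: Rogawski1990, §14.2 p. 233; §3.9 p. 32] [cite: Kottwitz1986, §3] [cite: PlatonovRapinchuk1994, §3.3] -/
theorem ncard_fixedBy_interior_sq_eq_of_frame (t : ((cmDatum L 3 H').Local v)) :
    {q : (((cmDatum L 3 H').Local v) ⧸ cmLocalIntegralLevel L 3 H' v) | q ∈ MulAction.fixedBy (((cmDatum L 3 H').Local v) ⧸ cmLocalIntegralLevel L 3 H' v) t ∧ ((redMat (((((q.out⁻¹ * t * q.out)).val : GL (Fin 3) (UnitaryGroup.LocalRing L v)).val.map (Pi.evalRingHom (fun w' : PlacesOver L v => w'.1.adicCompletion L) w))) - 1).rank = 0 ∧ (redMat (ϖ⁻¹ • (((((q.out⁻¹ * t * q.out)).val : GL (Fin 3) (UnitaryGroup.LocalRing L v)).val.map (Pi.evalRingHom (fun w' : PlacesOver L v => w'.1.adicCompletion L) w)) - 1))).rank = 1 ∧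
        ∃ (z : Fin 3 → 𝓀[(w.1.adicCompletion L)]) (a : 𝓀[(w.1.adicCompletion L)]), a ≠ 0 ∧ z ⬝ᵥ ((redMat (placeForm H' w.1) * redMat (ϖ⁻¹ • (((((q.out⁻¹ * t * q.out)).val : GL (Fin 3) (UnitaryGroup.LocalRing L v)).val.map (Pi.evalRingHom (fun w' : PlacesOver L v => w'.1.adicCompletion L) w)) - 1))) *ᵥ z) = a ^ 2)}.ncard =
      {q : (↥(unitaryGroupOfForm (galAdicCompletionMap (L := L) (IsCMField.complexConj L) hw) (placeForm (Matrix.of fun i j : Fin 3 => if i.val + j.val + 1 = 3 then (1 : L) else 0) w.1)) ⧸ ((glInt 3 (w.1.adicCompletion L)).subgroupOf (unitaryGroupOfForm (galAdicCompletionMap (L := L) (IsCMField.complexConj L) hw) (placeForm (Matrix.of fun i j : Fin 3 => if i.val + j.val + 1 = 3 then (1 : L) else 0) w.1)))) | q ∈ MulAction.fixedBy (↥(unitaryGroupOfForm (galAdicCompletionMap (L := L) (IsCMField.complexConj L) hw) (placeForm (Matrix.of fun i j : Fin 3 => if i.val + j.val + 1 = 3 then (1 : L) else 0) w.1)) ⧸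 ((glInt 3 (w.1.adicCompletion L)).subgroupOf (unitaryGroupOfForm (galAdicCompletionMap (L := L) (IsCMField.complexConj L) hw) (placeForm (Matrix.of fun i j : Fin 3 => if i.val + j.val + 1 = 3 then (1 : L) else 0) w.1)))) (e t) ∧ ((redMat (((((q.out⁻¹ * e t * q.out) : ↥(unitaryGroupOfForm (galAdicCompletionMap (L := L) (IsCMField.complexConj L) hw) (placeForm (Matrix.of fun i j : Fin 3 => if i.val + j.val + 1 = 3 then (1 : L) else 0) w.1))) : GL (Fin 3) (w.1.adicCompletion L)) : Matrix (Fin 3) (Fin 3) (w.1.adicCompletion L))) - 1).rank = 0 ∧ (redMat (ϖ⁻¹ • (((((q.out⁻¹ * e t * q.out) : ↥(unitaryGroupOfForm (galAdicCompletionMap (L := L) (IsCMField.complexConj L) hw) (placeForm (Matrix.of fun i j : Fin 3 => if i.val + j.val + 1 = 3 then (1 : L) else 0) w.1))) : GL (Fin 3) (w.1.adicCompletion L)) : Matrix (Fin 3) (Fin 3) (w.1.adicCompletion L)) - 1))).rank = 1 ∧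
        ∃ (z : Fin 3 → 𝓀[(w.1.adicCompletion L)]) (a : 𝓀[(w.1.adicCompletion L)]), a ≠ 0 ∧ red (-((placeForm H' w.1)).det) * (z ⬝ᵥ ((((StdForm.antidiagonal 3).over 𝓀[(w.1.adicCompletion L)]) * redMat (ϖ⁻¹ • (((((q.out⁻¹ * e t * q.out) : ↥(unitaryGroupOfForm (galAdicCompletionMap (L := L) (IsCMField.complexConj L) hw) (placeForm (Matrix.of fun i j : Fin 3 => if i.val + j.val + 1 = 3 then (1 : L) else 0) w.1))) : GL (Fin 3) (w.1.adicCompletion L)) : Matrix (Fin 3) (Fin 3) (w.1.adicCompletion L)) - 1))) *ᵥ z)) = a ^ 2)}.ncard := by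
  classical
  let Ab : GL (Fin 3) 𝓀[(w.1.adicCompletion L)] := ⟨redMat (A : Matrix (Fin 3) (Fin 3) (w.1.adicCompletion L)), redMat (((A⁻¹ : GL (Fin 3) (w.1.adicCompletion L))) : Matrix (Fin 3) (Fin 3) (w.1.adicCompletion L)),
    redMat_coe_mul_redMat_coe_inv hA, redMat_coe_inv_mul_redMat_coe hA⟩
  have hJb := redMat_placeForm_eq_smul_formCongr_redMat_of_frame L H' w hw he hH'w hH'i A hA hframe Ab rfl
  refine ncard_fixedBy_label_eq_of_frame L H' w hw e hK t
    (fun x => (redMat ((((x).val : GL (Fin 3) (UnitaryGroup.LocalRing L v)).val.map (Pi.evalRingHom (fun w' : PlacesOver L v => w'.1.adicCompletion L) w))) - 1).rank = 0 ∧ (redMat (ϖ⁻¹ • ((((x).val : GL (Fin 3) (UnitaryGroup.LocalRing L v)).val.map (Pi.evalRingHom (fun w' : PlacesOver L v => w'.1.adicCompletion L) w)) - 1))).rank = 1 ∧ ∃ (z : Fin 3 → 𝓀[(w.1.adicCompletion L)]) (a : 𝓀[(w.1.adicCompletion L)]), a ≠ 0 ∧ z ⬝ᵥ ((redMat (placeForm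 H' w.1) * redMat (ϖ⁻¹ • ((((x).val : GL (Fin 3) (UnitaryGroup.LocalRing L v)).val.map (Pi.evalRingHom (fun w' : PlacesOver L v => w'.1.adicCompletion L) w)) - 1))) *ᵥ z) = a ^ 2)
    (fun u => (redMat ((((u : ↥(unitaryGroupOfForm (galAdicCompletionMap (L := L) (IsCMField.complexConj L) hw) (placeForm (Matrix.of fun i j : Fin 3 => if i.val + j.val + 1 = 3 then (1 : L) else 0) w.1))) : GL (Fin 3) (w.1.adicCompletion L)) : Matrix (Fin 3) (Fin 3) (w.1.adicCompletion L))) - 1).rank = 0 ∧ (redMat (ϖ⁻¹ • ((((u : ↥(unitaryGroupOfForm (galAdicCompletionMap (L := L) (IsCMField.complexConj L) hw) (placeForm (Matrix.of fun i j : Fin 3 => if i.val + j.val + 1 = 3 then (1 : L) else 0) w.1))) : GL (Fin 3) (w.1.adicCompletion L)) : Matrix (Fin 3) (Fin 3) (w.1.adicCompletion L)) - 1))).rank = 1 ∧ ∃ (z : Fin 3 → 𝓀[(w.1.adicCompletion L)]) (a : 𝓀[(w.1.adicCompletion L)]), a ≠ 0 ∧ red (-((placeForm H' w.1)).det) * (z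 ⬝ᵥ ((((StdForm.antidiagonal 3).over 𝓀[(w.1.adicCompletion L)]) * redMat (ϖ⁻¹ • ((((u : ↥(unitaryGroupOfForm (galAdicCompletionMap (L := L) (IsCMField.complexConj L) hw) (placeForm (Matrix.of fun i j : Fin 3 => if i.val + j.val + 1 = 3 then (1 : L) else 0) w.1))) : GL (Fin 3) (w.1.adicCompletion L)) : Matrix (Fin 3) (Fin 3) (w.1.adicCompletion L)) - 1))) *ᵥ z)) = a ^ 2)
    (fun x hx => ?_) (fun k' hk' u hu => ?_)
  · obtain ⟨h1, h2⟩ := labels_frame_of_mem L H' w hw ϖ hϖ A hA e heA hx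
    have key : ∀ (hr0 : (redMat ((((x).val : GL (Fin 3) (UnitaryGroup.LocalRing L v)).val.map (Pi.evalRingHom (fun w' : PlacesOver L v => w'.1.adicCompletion L) w))) - 1).rank = 0),
        ((∃ (z : Fin 3 → 𝓀[(w.1.adicCompletion L)]) (a : 𝓀[(w.1.adicCompletion L)]), a ≠ 0 ∧ z ⬝ᵥ ((redMat (placeForm H' w.1) * redMat (ϖ⁻¹ • ((((x).val : GL (Fin 3) (UnitaryGroup.LocalRing L v)).val.map (Pi.evalRingHom (fun w' : PlacesOver L v => w'.1.adicCompletion L) w)) - 1))) *ᵥ z) = a ^ 2) ↔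
          ∃ (z : Fin 3 → 𝓀[(w.1.adicCompletion L)]) (a : 𝓀[(w.1.adicCompletion L)]), a ≠ 0 ∧ red (-((placeForm H' w.1)).det) * (z ⬝ᵥ ((((StdForm.antidiagonal 3).over 𝓀[(w.1.adicCompletion L)]) * redMat (ϖ⁻¹ • (((((e x) : ↥(unitaryGroupOfForm (galAdicCompletionMap (L := L) (IsCMField.complexConj L) hw) (placeForm (Matrix.of fun i j : Fin 3 => if i.val + j.val + 1 = 3 then (1 : L) else 0) w.1))) : GL (Fin 3) (w.1.adicCompletion L)) : Matrix (Fin 3) (Fin 3) (w.1.adicCompletion L)) - 1))) *ᵥ z)) = a ^ 2) := fun hr0 => by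
      rw [hJb, (h2 hr0).1]
      exact exists_sq_value_iff_frameConj Ab _ _
    constructor
    · rintro ⟨hr0, hr, hsq⟩; exact ⟨by rw [h1]; exact hr0, by rw [(h2 hr0).2]; exact hr, (key hr0).1 hsq⟩
    · rintro ⟨hr0, hr, hsq⟩
      have hr0' : (redMat ((((x).val : GL (Fin 3) (UnitaryGroup.LocalRing L v)).val.map (Pi.evalRingHom (fun w' : PlacesOver L v => w'.1.adicCompletion L) w))) - 1).rank = 0 := by rw [← h1]; exact hr0
      exact ⟨hr0', by rw [← (h2 hr0').2]; exact hr, (key hr0').2 hsq⟩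
  · obtain ⟨-, h0, h⟩ := labels_conj_of_mem_glInt L w hw he ϖ hϖ hk' hu
    constructor
    · rintro ⟨hr0, hr, hsq⟩
      have hr0' := h0.1 hr0
      exact ⟨hr0', by rw [← (h hr0').1]; exact hr, ((h hr0').2 _).1 hsq⟩
    · rintro ⟨hr0, hr, hsq⟩; exact ⟨h0.2 hr0, by rw [(h hr0).1]; exact hr, ((h hr0).2 _).2 hsq⟩

include hw he hH'w hH'i hϖ hA hframe heA hK in
set_option maxHeartbeats 1600000 in
-- budget only: statement-heavy CM-place tokens (two coset currencies).
/-- **A1′ (¬□)**: `n_¬□(t) = n′_¬□(e t)` — the interior rank-1 stratum of the other class (same twist, negated). [cite: Rogawski1990, §14.2 p. 233; §3.9 p. 32] [cite: Kottwitz1986, §3] -/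
theorem ncard_fixedBy_interior_nonsq_eq_of_frame (t : ((cmDatum L 3 H').Local v)) :
    {q : (((cmDatum L 3 H').Local v) ⧸ cmLocalIntegralLevel L 3 H' v) | q ∈ MulAction.fixedBy (((cmDatum L 3 H').Local v) ⧸ cmLocalIntegralLevel L 3 H' v) t ∧ ((redMat (((((q.out⁻¹ * t * q.out)).val : GL (Fin 3) (UnitaryGroup.LocalRing L v)).val.map (Pi.evalRingHom (fun w' : PlacesOver L v => w'.1.adicCompletion L) w))) - 1).rank = 0 ∧ (redMat (ϖ⁻¹ • (((((q.out⁻¹ * t * q.out)).val : GL (Fin 3) (UnitaryGroup.LocalRing L v)).val.map (Pi.evalRingHom (fun w' : PlacesOver L v => w'.1.adicCompletion L) w)) - 1))).rank = 1 ∧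
        ¬ ∃ (z : Fin 3 → 𝓀[(w.1.adicCompletion L)]) (a : 𝓀[(w.1.adicCompletion L)]), a ≠ 0 ∧ z ⬝ᵥ ((redMat (placeForm H' w.1) * redMat (ϖ⁻¹ • (((((q.out⁻¹ * t * q.out)).val : GL (Fin 3) (UnitaryGroup.LocalRing L v)).val.map (Pi.evalRingHom (fun w' : PlacesOver L v => w'.1.adicCompletion L) w)) - 1))) *ᵥ z) = a ^ 2)}.ncard =
      {q : (↥(unitaryGroupOfForm (galAdicCompletionMap (L := L) (IsCMField.complexConj L) hw) (placeForm (Matrix.of fun i j : Fin 3 => if i.val + j.val + 1 = 3 then (1 : L) else 0) w.1)) ⧸ ((glInt 3 (w.1.adicCompletion L)).subgroupOf (unitaryGroupOfForm (galAdicCompletionMap (L := L) (IsCMField.complexConj L) hw) (placeForm (Matrix.of fun i j : Fin 3 => if i.val + j.val + 1 = 3 then (1 : L) else 0) w.1)))) | q ∈ MulAction.fixedBy (↥(unitaryGroupOfForm (galAdicCompletionMap (L := L) (IsCMField.complexConj L) hw) (placeForm (Matrix.of fun i j : Fin 3 => if i.val + j.val + 1 = 3 then (1 : L) else 0) w.1))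 ⧸ ((glInt 3 (w.1.adicCompletion L)).subgroupOf (unitaryGroupOfForm (galAdicCompletionMap (L := L) (IsCMField.complexConj L) hw) (placeForm (Matrix.of fun i j : Fin 3 => if i.val + j.val + 1 = 3 then (1 : L) else 0) w.1)))) (e t) ∧ ((redMat (((((q.out⁻¹ * e t * q.out) : ↥(unitaryGroupOfForm (galAdicCompletionMap (L := L) (IsCMField.complexConj L) hw) (placeForm (Matrix.of fun i j : Fin 3 => if i.val + j.val + 1 = 3 then (1 : L) else 0) w.1))) : GL (Fin 3) (w.1.adicCompletion L)) : Matrix (Fin 3) (Fin 3) (w.1.adicCompletion L))) - 1).rank = 0 ∧ (redMat (ϖ⁻¹ • (((((q.out⁻¹ * e t * q.out) : ↥(unitaryGroupOfForm (galAdicCompletionMap (L := L) (IsCMField.complexConj L) hw) (placeForm (Matrix.of fun i j : Fin 3 => if i.val + j.val + 1 = 3 then (1 : L) else 0) w.1))) : GL (Fin 3) (w.1.adicCompletion L)) : Matrix (Fin 3) (Fin 3) (w.1.adicCompletion L)) - 1))).rank = 1 ∧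
        ¬ ∃ (z : Fin 3 → 𝓀[(w.1.adicCompletion L)]) (a : 𝓀[(w.1.adicCompletion L)]), a ≠ 0 ∧ red (-((placeForm H' w.1)).det) * (z ⬝ᵥ ((((StdForm.antidiagonal 3).over 𝓀[(w.1.adicCompletion L)]) * redMat (ϖ⁻¹ • (((((q.out⁻¹ * e t * q.out) : ↥(unitaryGroupOfForm (galAdicCompletionMap (L := L) (IsCMField.complexConj L) hw) (placeForm (Matrix.of fun i j : Fin 3 => if i.val + j.val + 1 = 3 then (1 : L) else 0) w.1))) : GL (Fin 3) (w.1.adicCompletion L)) : Matrix (Fin 3) (Fin 3) (w.1.adicCompletion L)) - 1))) *ᵥ z)) = a ^ 2)}.ncard := by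
  classical
  let Ab : GL (Fin 3) 𝓀[(w.1.adicCompletion L)] := ⟨redMat (A : Matrix (Fin 3) (Fin 3) (w.1.adicCompletion L)), redMat (((A⁻¹ : GL (Fin 3) (w.1.adicCompletion L))) : Matrix (Fin 3) (Fin 3) (w.1.adicCompletion L)),
    redMat_coe_mul_redMat_coe_inv hA, redMat_coe_inv_mul_redMat_coe hA⟩
  have hJb := redMat_placeForm_eq_smul_formCongr_redMat_of_frame L H' w hw he hH'w hH'i A hA hframe Ab rfl
  refine ncard_fixedBy_label_eq_of_frame L H' w hw e hK t
    (fun x => (redMat ((((x).val : GL (Fin 3) (UnitaryGroup.LocalRing L v)).val.map (Pi.evalRingHom (fun w' : PlacesOver L v => w'.1.adicCompletion L) w))) - 1).rank = 0 ∧ (redMat (ϖ⁻¹ • ((((x).val : GL (Fin 3) (UnitaryGroup.LocalRing L v)).val.map (Pi.evalRingHom (fun w' : PlacesOver L v => w'.1.adicCompletion L) w)) - 1))).rank = 1 ∧ ¬ ∃ (z : Fin 3 → 𝓀[(w.1.adicCompletion L)]) (a : 𝓀[(w.1.adicCompletion L)]), a ≠ 0 ∧ z ⬝ᵥ ((redMat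 (placeForm H' w.1) * redMat (ϖ⁻¹ • ((((x).val : GL (Fin 3) (UnitaryGroup.LocalRing L v)).val.map (Pi.evalRingHom (fun w' : PlacesOver L v => w'.1.adicCompletion L) w)) - 1))) *ᵥ z) = a ^ 2)
    (fun u => (redMat ((((u : ↥(unitaryGroupOfForm (galAdicCompletionMap (L := L) (IsCMField.complexConj L) hw) (placeForm (Matrix.of fun i j : Fin 3 => if i.val + j.val + 1 = 3 then (1 : L) else 0) w.1))) : GL (Fin 3) (w.1.adicCompletion L)) : Matrix (Fin 3) (Fin 3) (w.1.adicCompletion L))) - 1).rank = 0 ∧ (redMat (ϖ⁻¹ • ((((u : ↥(unitaryGroupOfForm (galAdicCompletionMap (L := L) (IsCMField.complexConj L) hw) (placeForm (Matrix.of fun i j : Fin 3 => if i.val + j.val + 1 = 3 then (1 : L) else 0) w.1))) : GL (Fin 3) (w.1.adicCompletion L)) : Matrix (Fin 3) (Fin 3) (w.1.adicCompletion L)) - 1))).rank = 1 ∧ ¬ ∃ (z : Fin 3 → 𝓀[(w.1.adicCompletion L)]) (a : 𝓀[(w.1.adicCompletion L)]), a ≠ 0 ∧ red (-((placeForm H'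 w.1)).det) * (z ⬝ᵥ ((((StdForm.antidiagonal 3).over 𝓀[(w.1.adicCompletion L)]) * redMat (ϖ⁻¹ • ((((u : ↥(unitaryGroupOfForm (galAdicCompletionMap (L := L) (IsCMField.complexConj L) hw) (placeForm (Matrix.of fun i j : Fin 3 => if i.val + j.val + 1 = 3 then (1 : L) else 0) w.1))) : GL (Fin 3) (w.1.adicCompletion L)) : Matrix (Fin 3) (Fin 3) (w.1.adicCompletion L)) - 1))) *ᵥ z)) = a ^ 2)
    (fun x hx => ?_) (fun k' hk' u hu => ?_)
  · obtain ⟨h1, h2⟩ := labels_frame_of_mem L H' w hw ϖ hϖ A hA e heA hx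
    have key : ∀ (hr0 : (redMat ((((x).val : GL (Fin 3) (UnitaryGroup.LocalRing L v)).val.map (Pi.evalRingHom (fun w' : PlacesOver L v => w'.1.adicCompletion L) w))) - 1).rank = 0),
        ((∃ (z : Fin 3 → 𝓀[(w.1.adicCompletion L)]) (a : 𝓀[(w.1.adicCompletion L)]), a ≠ 0 ∧ z ⬝ᵥ ((redMat (placeForm H' w.1) * redMat (ϖ⁻¹ • ((((x).val : GL (Fin 3) (UnitaryGroup.LocalRing L v)).val.map (Pi.evalRingHom (fun w' : PlacesOver L v => w'.1.adicCompletion L) w)) - 1))) *ᵥ z) = a ^ 2) ↔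
          ∃ (z : Fin 3 → 𝓀[(w.1.adicCompletion L)]) (a : 𝓀[(w.1.adicCompletion L)]), a ≠ 0 ∧ red (-((placeForm H' w.1)).det) * (z ⬝ᵥ ((((StdForm.antidiagonal 3).over 𝓀[(w.1.adicCompletion L)]) * redMat (ϖ⁻¹ • (((((e x) : ↥(unitaryGroupOfForm (galAdicCompletionMap (L := L) (IsCMField.complexConj L) hw) (placeForm (Matrix.of fun i j : Fin 3 => if i.val + j.val + 1 = 3 then (1 : L) else 0) w.1))) : GL (Fin 3) (w.1.adicCompletion L)) : Matrix (Fin 3) (Fin 3) (w.1.adicCompletion L)) - 1))) *ᵥ z)) = a ^ 2) := fun hr0 => by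
      rw [hJb, (h2 hr0).1]
      exact exists_sq_value_iff_frameConj Ab _ _
    constructor
    · rintro ⟨hr0, hr, hsq⟩; exact ⟨by rw [h1]; exact hr0, by rw [(h2 hr0).2]; exact hr, fun h' => hsq ((key hr0).2 h')⟩
    · rintro ⟨hr0, hr, hsq⟩
      have hr0' : (redMat ((((x).val : GL (Fin 3) (UnitaryGroup.LocalRing L v)).val.map (Pi.evalRingHom (fun w' : PlacesOver L v => w'.1.adicCompletion L) w))) - 1).rank = 0 := by rw [← h1]; exact hr0
      exact ⟨hr0', by rw [← (h2 hr0').2]; exact hr, fun h' => hsq ((key hr0').1 h')⟩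
  · obtain ⟨-, h0, h⟩ := labels_conj_of_mem_glInt L w hw he ϖ hϖ hk' hu
    constructor
    · rintro ⟨hr0, hr, hsq⟩
      have hr0' := h0.1 hr0
      exact ⟨hr0', by rw [← (h hr0').1]; exact hr, fun h' => hsq (((h hr0').2 _).2 h')⟩
    · rintro ⟨hr0, hr, hsq⟩; exact ⟨h0.2 hr0, by rw [(h hr0).1]; exact hr, fun h' => hsq (((h hr0).2 _).1 h')⟩

end Transport

end Literature.NumberTheory.Automorphic.UnitaryGroup

end
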